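/-
Copyright: lit-balaban cell, Phase-2 proof seat p11 (gen 5).  Statement-level skeleton of a published paper; no proof claims beyond
what the kernel checks below.
-/
import Literature.MathematicalPhysics.QuantumFieldTheory.BalabanImbrieJaffe1984to88.BIJ85CovariantPoincare
import Literature.MathematicalPhysics.QuantumFieldTheory.BalabanImbrieJaffe1984to88.BIJ85Ineq732PullBack

/-!
# `BalabanImbrieJaffe1984to88.BIJ85Ineq732General` — T. Bałaban, J. Imbrie, A. Jaffe, *Renormalization of the Higgs model:
minimizers, propagators and the stability of mean field theory*, Commun. Math. Phys. **97** (1985) 299–329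
[BalabanImbrieJaffe1985]: Sect. 7.3 p. 326 — **THE SCALAR STABILITY ESTIMATE (7.3.2) AT A GENERAL `U(1)` BACKGROUND**, on the torus
model of record, every level `k`, every torus, with constants `γ`, `M` depending on `(a, d)` only.  For every `U(1)` field `u` on the
`η`-lattice whose plaquette variables deviate from `1` by at most `θ`, with `s := L^{2k}θ` (the field strength measured at the unit scale,
`η = L^{−k}`) and `u_k(b)` := the transport of `u` along the unit-lattice bond `b` (`lineIter u k`):
`⟨ψ, Δ_k(u)ψ⟩ ≥ γ·Σ_{b∈T₁^{(k)}} |u_k(b)ψ(b₊) − ψ(b₋)|² − (4/3)d⁴·s²·Σ_{x∈T₁^{(k)}} |ψ(x)|²`, `γ = min(a/(9(d+1)), 1/12)` (printed `a_k`,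
physical normalization); the typed claim `ScalarStabData.Claim73` for the family of all `η`-smooth backgrounds follows in file 5
(`BIJ85Claim73Smooth`).  File 4 of the general-background member of SKELETON row **C1.Eq7.3.1-7.3.2** (seat p11 gen 5; files 1–3
`BIJ85AbelianStokes`, `BIJ85HolonomyDefect`, `BIJ85CovariantPoincare`, file 5 `BIJ85Claim73Smooth`; the flat / pure-gauge member is gen 4's
`BIJ85Ineq732Flat`, the pull-back member `BIJ85Ineq732PullBack`).

RELATION TO THE OTHER PROVED MEMBERS OF THE ROW.  gen 4's `BIJ85Ineq732Flat` (`u = 1`, `M = 0`), p33 g6's `BIJ85Ineq732PullBack`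
(`u = Q^{s*}_k v`, every `v`, `M = 0`) and `BIJ85Ineq732BackgroundStab` / `BIJ85Claim73Background` (the (4.5.4)-SHAPED background
`u = Q^{s*}_k v·e^{iθ}` with a BONDWISE small phase `|θ_b| ≤ T`, error `∝ (L^kT)²`; landed while this file was written) fix the form or the
gauge of the background; the present member assumes NOTHING about the form or the gauge of `u` — only the gauge-invariant smallness
`‖u(∂p) − 1‖ ≤ θ` of its `η`-lattice plaquette variables (the field strength), error `∝ (L^{2k}θ)²` — the kind of hypothesis under which
[7] (= B4: fields of small curvature) argues; the price is the Sect. 7.2 input named under HONEST SCOPE.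

statement-level skeleton of published theorems with citation tags; proofs where landed; nothing here is a claim about the Yang–Mills mass gap

PDF held: `paper:balaban1985-cmp97-bij-higgs-minimizers` (journal page = PDF page + 298).  Pages read this session (`lit read`, OCR text):
p. 325–326 [PDF 27–28].

CITATION HEADER (lean-in-tree rule).  Phase-2 file of the lit-balaban TYPED SKELETON (HOME `run/shared/lean/pub/lit-balaban/`), seat
p11 gen 5 (unit `lit-balaban-p11-g5`; TAKING line HOME/STATUS.md 2026-08-21T10:52:36Z; owner r15, referee ref-5; free-target protocol
G.5-34(d), own lane).  WHAT IS REPRODUCED: SKELETON row **C1.Eq7.3.1-7.3.2** (`typed p239582`, r15: *"NO printed proof — 'extension of the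
proofs of [7]' = B4"*), as a PROVED MEMBER at a GENERAL background, narrowing HOME/GAPS.md G-C1-05: its items (i) (holonomy defects ←
plaquettes) and (ii) (the `u`-uniform Poincaré / mass bound) are files 2–3; what remains of the printed claim is ONLY the Sect. 7.2
regularity input *"(7.3.1) for v and the structure (4.5.4) of u_k ⇒ L^{2k}·max_p|u_k(∂p) − 1| ≤ C·e_k𝓅(e_k)"* (the `η`-scale form of
(7.3.1) for the actual background), which is where [6I] Prop. 1.2 / (7.2.2) enter.

THE PRINTED TEXT, verbatim (p. 326 [PDF 28]): *"7.3. Positivity of Δ_k(u_k).  The scalar field quadratic form Δ_k(u_k) depends on the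
background field u_k. Hence we can only establish stability properties for Δ_k(u_k) with some restriction on u_k. In particular, let
us assume that for the unit lattice field v, |v(∂p) − 1| ≤ e_k𝓅(e_k), (7.3.1) where 𝓅(e_k) = (1 + ln e_k^{−1})^𝓅. Then the stability
estimate can be stated in two forms. For constants γ > 0, α > 0, M < ∞, ⟨φ, Δ_k(u_k)φ⟩ ≥ γ Σ_{b∈T₁^{(k)}} |u_k(b)φ(b₊) − φ(b₋)|² −
Me_k^{2−α} Σ_{x∈T₁^{(k)}} |φ(x)|². (7.3.2) The second form of the inequality substitutes v_b for u_k(b) in the covariant derivative of φ.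
These inequalities can be proved by an extension of the proofs of [7]. The propagators arising from Δ_k(u_k), under the restriction
(7.3.1) on the gauge field, also satisfy the regularity and decay estimates of [7]."*

WHAT IS PROVED HERE (0 `sorry`, standard axioms).  Carriers of record only (`FineSp`/`CoarseSpK`, `Dlin c u`, `QlinK u k` = `Q_k(u)`,
`Δ_k(u) = BIJ85ScalarForm464.deltaOp (QlinK u k) a G` with `G = G_k(u)` any right inverse of `D^*D + aQ_k^*Q_k` — it exists for every `u`,
gen 3's `exists_GK`; gen 4's `bondForm W ψ = Σ_b|W(b)ψ(b₊) − ψ(b₋)|²`, `cPhys`).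
* §1 **`ineq732_general`**: for every torus, every `k` (`j + k ≤ m + K`), `a > 0`, `c ≠ 0`, every `U(1)` field `u` with `‖plaqC u x μ ν − 1‖ ≤ θ`,
  every `G` and every unit-lattice field `ψ`:
  `min(a/(8(d+1)), Nc²/(12n²))·Σ_b|u_k(b)ψ(b₊) − ψ(b₋)|² − (4/3)d⁴(Nc²/n²)(n²θ)²‖ψ‖² ≤ ⟨ψ, Δ_k(u)ψ⟩` (`n = L^k`, `N = L^{kd}`).
  Mechanism (the gen-4 flat route with the two new inputs): `⟨ψ,Δ_kψ⟩ = a‖Q_kφ_k − ψ‖² + ‖D_uφ_k‖²` at the minimizer; `E(ψ) ≤ 2E(ψ − Q_kφ_k) +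
  2E(Q_kφ_k) ≤ 8d‖ψ − Q_kφ_k‖² + 2E(Q_kφ_k)`; `E(Q_kφ_k) ≤ 2(n²/N)Σ|D_uφ_k|² + 2d³s²N^{−1}Σ|φ_k|²` (gen 4's covariant block-averaging
  inequality, its defect bounded by file 2); `N^{−1}Σ|φ_k|² ≤ Σ|Q_kφ_k|² + 2(n²/N)Σ|D_uφ_k|² + d³s²N^{−1}Σ|φ_k|²` (file 3's mass bound) — absorbed
  when `d³s² ≤ ½`, and when `d³s² > ½` the claim is implied by `Δ_k ≥ 0` and `E(ψ) ≤ 4d‖ψ‖²`.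
* §2 **`ineq732_general_phys`**: the printed `a_k` (`≥ 8a/9`, gen 4) and the physical normalization `c² = η^{d−2} = n²/N`:
  `min(a/(9(d+1)), 1/12)·E_{u_k}(ψ) − (4/3)d⁴s²‖ψ‖² ≤ ⟨ψ, Δ_k(u)ψ⟩`, `s = n²θ`, UNIFORM in `k`, `L`, the volume and `u`.
* §3 **`sq_hyp731_le`**: the elementary bound turning the hypothesis (7.3.1) into the printed error term `Me_k^{2−α}`:
  `(e(1 + ln e^{−1})^𝓅)² ≤ (1+4𝓅₊)^{2𝓅₊}·e^{2−½}` for `0 < e ≤ 1` (`𝓅₊ = max(𝓅,0)`).  r15's typed `ScalarStabData.Claim73` for the family of all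
  `η`-smooth backgrounds (`γ = min(a/(9(d+1)), 1/12)`, `α = ½`, `M = (4/3)d⁴(1+4𝓅₊)^{2𝓅₊}`) is inhabited from §2–§3 in file 5 `BIJ85Claim73Smooth`.
HONEST SCOPE.  (1) The hypothesis is placed on the `η`-lattice plaquettes of the background (`|u(∂p) − 1| ≤ θ`, error `∝ (L^{2k}θ)²`); the
paper places (7.3.1) on the unit-lattice field `v` from which `u_k` is built by (4.5.4) — deriving `L^{2k}θ ≲ e_k𝓅(e_k)` for that `u_k` is the
regularity of the minimizers, Sect. 7.2 / [6I] Prop. 1.2, NOT done here (HOME/GAPS.md G-C1-05, narrowed).  (2) First printed form (`u_k(b)`);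
the second form (`v_b`) differs by the defect `u_k(b)v_b^{−1}`, not treated.  (3) Constants not optimized.
-/

open scoped RealInnerProductSpace BigOperators
open Finset

namespace Literature.MathematicalPhysics.QuantumFieldTheory.BalabanImbrieJaffe1984to88.BIJ85Ineq732General

open Literature.MathematicalPhysics.QuantumFieldTheory.Balaban1983to89
open BIJ88Sect3Statements (U1 toC toC_one toC_mul norm_toC)
open BIJ85Sect1Model (HiggsField)
open BIJ85BlockAveragesTorus BIJ85BlockAveragesTorusK BIJ85ScalarPropagatorTorus BIJ85ScalarPropagatorTorusK
open BIJ85ScalarForm464 BIJ85Eq461Proof BIJ85BlockAveragingIneq BIJ85Ineq732Flat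
open BIJ85AbelianStokes BIJ85HolonomyDefect BIJ85CovariantPoincare
open BIJ85Ineq732PullBack (norm_Dlin_sq')

noncomputable section

variable {P : Params} {j : ℕ}

/-! ## §1 (7.3.2) at a general background -/

/-- kernel: `‖Q_k(u)φ‖² = Σ_y|(Q_k(u)φ)(y)|²`. [cite: BalabanImbrieJaffe1985, (4.6.1) p.313] -/
theorem norm_QlinK_sq (U : GaugeField P j U1) (k : ℕ) (φ : FineSp P j) :
    ‖QlinK U k φ‖ ^ 2 = ∑ y : Balaban1983to89.Site P (j+k), ‖qCovK U k (WithLp.ofLp φ) y‖ ^ 2 := by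
  rw [PiLp.norm_sq_eq_of_L2]
  rfl

/-- kernel (real arithmetic): `p ≤ q + r`, all non-negative ⇒ `p² ≤ 2q² + 2r²`. [folklore] -/
private theorem sq_le_two_sq_add {p q r : ℝ} (hq : 0 ≤ q) (hr : 0 ≤ r) (h : p ≤ q + r) (hp : 0 ≤ p) :
    p ^ 2 ≤ 2 * q ^ 2 + 2 * r ^ 2 := by
  nlinarith [mul_nonneg hp (sub_nonneg.2 h), mul_nonneg hq (sub_nonneg.2 h), mul_nonneg hr (sub_nonneg.2 h),
    sq_nonneg (q - r)]

/-- kernel (real arithmetic): THE ASSEMBLY of (7.3.2) at a general background from its five inputs — the value of the form at the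
minimizer `aX + Y` (`Y = c²E`), the splitting `E_W(ψ) ≤ 2E_W(ψ − Q_kφ_k) + 2E_W(Q_kφ_k)`, `E_W(ψ − Q_kφ_k) ≤ 4dX`, the covariant
block-averaging inequality with defect (`h2`), the mass bound (`h3`), `‖Q_kφ_k‖² ≤ 2X + 2‖ψ‖²` and `E_W(ψ) ≤ 4d‖ψ‖²`; two regimes
`d³s² ≤ ½` (absorb) and `d³s² > ½` (the claim follows from `Δ_k ≥ 0`). [folklore] -/
private theorem assembly_real {a c2 X Y E S0 Qn EW EQ B1 Ψ n2 N dd θ : ℝ}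
    (ha : 0 < a) (hc2 : 0 < c2) (hN : 0 < N) (hn2 : 0 < n2) (hdd1 : 1 ≤ dd)
    (hX0 : 0 ≤ X) (hE0 : 0 ≤ E) (hS0 : 0 ≤ S0) (hΨ0 : 0 ≤ Ψ)
    (hY : Y = c2 * E) (hsplit : EW ≤ 2 * B1 + 2 * EQ) (hB1 : B1 ≤ 4 * dd * X)
    (h2 : EQ ≤ 2 * (n2 / N) * E + 2 * dd ^ 3 * (n2 * θ) ^ 2 * (N⁻¹ * S0))
    (h3 : N⁻¹ * S0 ≤ Qn + 2 * n2 * N⁻¹ * E + dd ^ 3 * (n2 * θ) ^ 2 * (N⁻¹ * S0))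
    (h4 : Qn ≤ 2 * X + 2 * Ψ) (hEW4 : EW ≤ 4 * dd * Ψ) :
    min (a / (8 * (dd + 1))) (N * c2 / (12 * n2)) * EW - 4 / 3 * dd ^ 4 * (N * c2 / n2) * (n2 * θ) ^ 2 * Ψ
      ≤ a * X + Y := by
  obtain ⟨γ, hγ⟩ : ∃ γ : ℝ, γ = min (a / (8 * (dd + 1))) (N * c2 / (12 * n2)) := ⟨_, rfl⟩
  obtain ⟨Γ, hΓ⟩ : ∃ Γ : ℝ, Γ = N * c2 / (12 * n2) := ⟨_, rfl⟩
  obtain ⟨t, ht⟩ : ∃ t : ℝ, t = dd ^ 3 * (n2 * θ) ^ 2 := ⟨_, rfl⟩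
  obtain ⟨F, hF⟩ : ∃ F : ℝ, F = n2 * N⁻¹ * E := ⟨_, rfl⟩
  obtain ⟨R, hR⟩ : ∃ R : ℝ, R = N⁻¹ * S0 := ⟨_, rfl⟩
  rw [← hγ]
  have hN0 : N ≠ 0 := hN.ne'
  have hn20 : n2 ≠ 0 := hn2.ne'
  have hdd0 : 0 ≤ dd := by linarith
  have hΓ0 : 0 ≤ Γ := by rw [hΓ]; positivity
  have hγ0 : 0 ≤ γ := by rw [hγ]; exact le_min (by positivity) (by positivity)
  have hγ1 : γ * (8 * (dd + 1)) ≤ a := by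
    have h := min_le_left (a / (8 * (dd + 1))) (N * c2 / (12 * n2))
    rw [← hγ, le_div_iff₀ (by positivity)] at h
    exact h
  have hγ2 : γ ≤ Γ := by rw [hγ, hΓ]; exact min_le_right _ _
  have ht0 : 0 ≤ t := by rw [ht]; positivity
  have hF0 : 0 ≤ F := by rw [hF]; positivity
  have hR0 : 0 ≤ R := by rw [hR]; positivity
  have hY' : Y = 12 * Γ * F := by
    rw [hY, hΓ, hF]
    have e : 12 * (N * c2 / (12 * n2)) * (n2 * N⁻¹ * E) = c2 * E * (N * N⁻¹) * (n2 * n2⁻¹) := by ring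
    rw [e, mul_inv_cancel₀ hN0, mul_inv_cancel₀ hn20, mul_one, mul_one]
  have e2a : 2 * (n2 / N) * E = 2 * F := by rw [hF, div_eq_mul_inv]; ring
  have e2b : 2 * dd ^ 3 * (n2 * θ) ^ 2 * (N⁻¹ * S0) = 2 * (t * R) := by rw [ht, hR]; ring
  have e3a : 2 * n2 * N⁻¹ * E = 2 * F := by rw [hF]; ring
  have e3b : dd ^ 3 * (n2 * θ) ^ 2 * (N⁻¹ * S0) = t * R := by rw [ht, hR]
  have eM : 4 / 3 * dd ^ 4 * (N * c2 / n2) * (n2 * θ) ^ 2 * Ψ = 16 * (Γ * (dd * Ψ) * t) := by rw [hΓ, ht]; ring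
  have h2' : EQ ≤ 2 * F + 2 * (t * R) := by linarith
  have h3' : R ≤ Qn + 2 * F + t * R := by linarith
  have pA1 : γ * (8 * (dd + 1)) * X ≤ a * X := mul_le_mul_of_nonneg_right hγ1 hX0
  have pA2 : γ * F ≤ Γ * F := mul_le_mul_of_nonneg_right hγ2 hF0
  have hpos : 0 ≤ a * X + Y := by rw [hY]; positivity
  rw [eM]
  by_cases hA : t ≤ 1 / 2
  · -- small field strength: absorb the mass term
    have p1 : t * R ≤ 1 / 2 * R := mul_le_mul_of_nonneg_right hA hR0
    have hRb : R ≤ 2 * Qn + 4 * F := by linarith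
    have p2 : t * R ≤ t * (2 * Qn + 4 * F) := mul_le_mul_of_nonneg_left hRb ht0
    have p3 : t * Qn ≤ t * (2 * X + 2 * Ψ) := mul_le_mul_of_nonneg_left h4 ht0
    have p4 : t * X ≤ 1 / 2 * X := mul_le_mul_of_nonneg_right hA hX0
    have p5 : t * F ≤ 1 / 2 * F := mul_le_mul_of_nonneg_right hA hF0
    have hEWb : EW ≤ (8 * dd + 8) * X + 12 * F + 16 * (t * Ψ) := by linarith
    have pEW : γ * EW ≤ γ * ((8 * dd + 8) * X + 12 * F + 16 * (t * Ψ)) := mul_le_mul_of_nonneg_left hEWb hγ0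
    have q3 : t ≤ dd * t := by nlinarith [mul_nonneg (sub_nonneg.2 hdd1) ht0]
    have pM : γ * t * Ψ ≤ Γ * (dd * t) * Ψ := mul_le_mul_of_nonneg_right (mul_le_mul hγ2 q3 ht0 hΓ0) hΨ0
    rw [hY']
    linarith
  · -- large field strength: the claim follows from `Δ_k ≥ 0` and `E_W(ψ) ≤ 4d‖ψ‖²`
    have hA' : 1 / 2 < t := lt_of_not_ge hA
    have q1 : γ * EW ≤ γ * (4 * dd * Ψ) := mul_le_mul_of_nonneg_left hEW4 hγ0
    have r2 : γ * (dd * Ψ) ≤ Γ * (dd * Ψ) := mul_le_mul_of_nonneg_right hγ2 (by positivity)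
    have r0 : 0 ≤ Γ * (dd * Ψ) * t := by positivity
    have r1 : Γ * (dd * Ψ) * (1 / 2) ≤ Γ * (dd * Ψ) * t := mul_le_mul_of_nonneg_left hA'.le (by positivity)
    linarith

/-- **(7.3.2) AT A GENERAL `U(1)` BACKGROUND, EVERY LEVEL `k`, EVERY TORUS.**  For `j + k ≤ m + K`, `a > 0`, `c ≠ 0`, every `U(1)` field `u`
on the `η`-lattice `T^{(j)}` whose (oriented) plaquette variables deviate from `1` by at most `θ`, `G` any right inverse of `D_u^*D_u +
aQ_k(u)^*Q_k(u)` (it exists: `exists_GK`) and every unit-lattice scalar field `ψ`, with `n = L^k`, `N = L^{kd}`, `u_k(b) = lineIter u k b`: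
`min(a/(8(d+1)), Nc²/(12n²))·Σ_{b∈T₁^{(k)}}|u_k(b)ψ(b₊) − ψ(b₋)|² − (4/3)d⁴(Nc²/n²)(n²θ)²·‖ψ‖² ≤ ⟨ψ, Δ_k(u)ψ⟩` — the printed shape
`γΣ_b|u_k(b)φ(b₊) − φ(b₋)|² − (error)Σ_x|φ(x)|² ≤ ⟨φ, Δ_k(u_k)φ⟩` with the error measured by the field strength `s = n²θ` of the background at the
unit scale.  Mechanism: `⟨ψ,Δ_kψ⟩ = a‖Q_kφ_k − ψ‖² + ‖D_uφ_k‖²` at the minimizer `φ_k`; `E(ψ) ≤ 8d‖ψ − Q_kφ_k‖² + 2E(Q_kφ_k)`; `E(Q_kφ_k) ≤ 2(n²/N)Σ|D_uφ_k|²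
+ 2d³s²N^{−1}Σ|φ_k|²` (file 3, from gen 4's covariant block-averaging inequality and file 2's defect bound); `N^{−1}Σ|φ_k|² ≤ Σ|Q_kφ_k|² +
2(n²/N)Σ|D_uφ_k|² + d³s²N^{−1}Σ|φ_k|²` (file 3's mass bound); assembled in `assembly_real`. [cite: BalabanImbrieJaffe1985, (7.3.2) p.326] -/
theorem ineq732_general {k : ℕ} (hk : j + k ≤ P.m + P.K) {c : ℝ} (hc : c ≠ 0) {a : ℝ} (ha : 0 < a) (U : GaugeField P j U1) {θ : ℝ}
    (hθ : ∀ (x : Balaban1983to89.Site P j) (μ ν : Fin P.d), ‖plaqC U x μ ν - 1‖ ≤ θ)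
    {G : FineSp P j →ₗ[ℝ] FineSp P j} (hG : ∀ φ, opT (Dlin c U) (QlinK U k) a (G φ) = φ) (ψ : CoarseSpK P j k) :
    min (a / (8 * (P.d + 1))) ((P.L : ℝ) ^ (k * P.d) * c ^ 2 / (12 * ((P.L : ℝ) ^ k) ^ 2)) * bondForm (lineIter U k) ψ
        - 4 / 3 * (P.d : ℝ) ^ 4 * ((P.L : ℝ) ^ (k * P.d) * c ^ 2 / ((P.L : ℝ) ^ k) ^ 2) * (((P.L : ℝ) ^ k) ^ 2 * θ) ^ 2 * ‖ψ‖ ^ 2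
      ≤ ⟪ψ, deltaOp (QlinK U k) a G ψ⟫ := by
  have hLpos : (0 : ℝ) < P.L := Nat.cast_pos.2 P.L_pos
  have hNpos : (0 : ℝ) < (P.L : ℝ) ^ (k * P.d) := pow_pos hLpos _
  have hn2pos : (0 : ℝ) < ((P.L : ℝ) ^ k) ^ 2 := pow_pos (pow_pos hLpos _) _
  have hc2 : 0 < c ^ 2 := by positivity
  have hdd1 : (1 : ℝ) ≤ P.d := by exact_mod_cast P.hd
  -- the minimizer φ_k = aGQ_k^*ψ
  set φk : FineSp P j := phiCl (QlinK U k) a G ψ with hφk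
  clear_value φk
  have hX0 : 0 ≤ ‖QlinK U k φk - ψ‖ ^ 2 := by positivity
  have hE0 : 0 ≤ ∑ b : PBond P j, ‖toC (U b) * φk b.tgt - φk b.src‖ ^ 2 := sum_nonneg fun _ _ => by positivity
  have hS00 : 0 ≤ ∑ x : Balaban1983to89.Site P j, ‖φk x‖ ^ 2 := sum_nonneg fun _ _ => by positivity
  have hΨ0 : 0 ≤ ‖ψ‖ ^ 2 := by positivity
  -- (1) E_W(ψ) ≤ 2E_W(ψ − Q_kφ_k) + 2E_W(Q_kφ_k), E_W(ψ − Q_kφ_k) ≤ 4d‖Q_kφ_k − ψ‖²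
  have hsplit : bondForm (lineIter U k) ψ
      ≤ 2 * bondForm (lineIter U k) (ψ - QlinK U k φk) + 2 * bondForm (lineIter U k) (QlinK U k φk) := by
    simpa only [sub_add_cancel] using bondForm_add_le (lineIter U k) (ψ - QlinK U k φk) (QlinK U k φk)
  have hB1 : bondForm (lineIter U k) (ψ - QlinK U k φk) ≤ 4 * P.d * ‖QlinK U k φk - ψ‖ ^ 2 := by
    rw [norm_sub_rev (QlinK U k φk) ψ]
    exact bondForm_le _ _
  -- (2) the covariant block-averaging inequality with its defect bounded (file 3)
  have h2 : bondForm (lineIter U k) (QlinK U k φk) ≤ _ := bondForm_qCovK_le hk U hθ (WithLp.ofLp φk)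
  -- (3) the mass bound (file 3)
  have h3 := massBound hk U hθ (WithLp.ofLp φk)
  -- (4) ‖Q_kφ_k‖² ≤ 2‖Q_kφ_k − ψ‖² + 2‖ψ‖²
  have h4 : ∑ y : Balaban1983to89.Site P (j+k), ‖qCovK U k (WithLp.ofLp φk) y‖ ^ 2
      ≤ 2 * ‖QlinK U k φk - ψ‖ ^ 2 + 2 * ‖ψ‖ ^ 2 := by
    rw [← norm_QlinK_sq]
    have h := norm_add_le (QlinK U k φk - ψ) ψ
    rw [sub_add_cancel] at h
    exact sq_le_two_sq_add (norm_nonneg _) (norm_nonneg _) h (norm_nonneg _)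
  -- (5) E_W(ψ) ≤ 4d‖ψ‖², and the value of the form at the minimizer
  have hEW4 := bondForm_le (lineIter U k) ψ
  rw [inner_deltaOp_eq hG ψ, ← hφk]
  exact assembly_real ha hc2 hNpos hn2pos hdd1 hX0 hE0 hS00 hΨ0 (norm_Dlin_sq' c U φk) hsplit hB1 h2 h3 h4 hEW4

/-! ## §2 The printed `a_k` and the physical normalization: constants uniform in `k`, `L`, the volume and `u` -/

/-- kernel: at the physical normalization `c² = η^{d−2} = n²/N` the geometric factor `Nc²/n²` is `1`. [cite: BalabanImbrieJaffe1985, (2.2) p.302] -/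
theorem cPhys_ratio (P : Params) (k : ℕ) : (P.L : ℝ) ^ (k * P.d) * cPhys P k ^ 2 / ((P.L : ℝ) ^ k) ^ 2 = 1 := by
  have h1 : (0 : ℝ) < (P.L : ℝ) ^ (k * P.d) := pow_pos (Nat.cast_pos.2 P.L_pos) _
  have h2 : (0 : ℝ) < ((P.L : ℝ) ^ k) ^ 2 := pow_pos (pow_pos (Nat.cast_pos.2 P.L_pos) _) _
  rw [cPhys_sq, mul_div_assoc', mul_div_cancel_left₀ _ h1.ne', div_self h2.ne']

/-- **(7.3.2) AT A GENERAL BACKGROUND WITH THE PRINTED `a_k` AND UNIFORM CONSTANTS**: for `1 ≤ k`, `j + k ≤ m + K`, `a > 0` (the constant of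
the one-step Gaussian), every `U(1)` field `u` on the `η`-lattice with plaquette variables within `θ` of `1`, `G` the inverse (4.6.2) at `u`
(physical normalization `cPhys`, coefficient `a_k`) and every `ψ`, with `s = L^{2k}θ`:
`min(a/(9(d+1)), 1/12)·Σ_{b∈T₁^{(k)}}|u_k(b)ψ(b₊) − ψ(b₋)|² − (4/3)d⁴s²‖ψ‖² ≤ ⟨ψ, Δ_k(u)ψ⟩` — `γ` and the error coefficient depend on `(a, d)`
only. [cite: BalabanImbrieJaffe1985, (7.3.2) p.326] -/
theorem ineq732_general_phys {k : ℕ} (hk1 : 1 ≤ k) (hk : j + k ≤ P.m + P.K) {a : ℝ} (ha : 0 < a) (U : GaugeField P j U1) {θ : ℝ}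
    (hθ : ∀ (x : Balaban1983to89.Site P j) (μ ν : Fin P.d), ‖plaqC U x μ ν - 1‖ ≤ θ)
    {G : FineSp P j →ₗ[ℝ] FineSp P j}
    (hG : ∀ φ, opT (Dlin (cPhys P k) U) (QlinK U k) (BIJ85Sect4Statements.aK a P.L k) (G φ) = φ)
    (ψ : CoarseSpK P j k) :
    min (a / (9 * (P.d + 1))) (1 / 12) * bondForm (lineIter U k) ψ
        - 4 / 3 * (P.d : ℝ) ^ 4 * (((P.L : ℝ) ^ k) ^ 2 * θ) ^ 2 * ‖ψ‖ ^ 2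
      ≤ ⟪ψ, deltaOp (QlinK U k) (BIJ85Sect4Statements.aK a P.L k) G ψ⟫ := by
  have hL : (1 : ℝ) < P.L := by linarith [three_le_L P]
  have haK := (BIJ85CoefficientAk464.aK_pos_le ha hL hk1).1
  have h := ineq732_general hk (cPhys_pos P k).ne' haK U hθ hG ψ
  have hr := cPhys_ratio P k
  have e12 : (P.L : ℝ) ^ (k * P.d) * cPhys P k ^ 2 / (12 * ((P.L : ℝ) ^ k) ^ 2) = 1 / 12 := by
    rw [mul_comm (12 : ℝ), ← div_div, hr]
  rw [e12, hr, mul_one] at h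
  refine le_trans ?_ h
  have hE0 := bondForm_nonneg (lineIter U k) ψ
  have hd : (0 : ℝ) < P.d := Nat.cast_pos.2 P.hd
  have hmin : min (a / (9 * (P.d + 1))) (1 / 12) ≤ min (BIJ85Sect4Statements.aK a P.L k / (8 * (P.d + 1))) (1 / 12) := by
    refine min_le_min ?_ le_rfl
    rw [div_le_div_iff₀ (by positivity) (by positivity)]
    nlinarith [aK_ge_eight_ninths P ha.le hk1]
  nlinarith [mul_le_mul_of_nonneg_right hmin hE0]

/-! ## §3 The elementary bound behind the error term `Me_k^{2−α}`: `(e𝓅(e))² ≤ (1+4𝓅₊)^{2𝓅₊}e^{3/2}` -/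

/-- kernel (the only analysis in the error term): **`(e·(1 + ln e^{−1})^𝓅)² ≤ (1+4𝓅₊)^{2𝓅₊}·e^{2−½}` for `0 < e ≤ 1`** — from
`ln t ≤ t^β/β` (`β = 1/(4𝓅)`), so `1 + ln t ≤ (1 + 4𝓅)t^β` and `(1 + ln t)^{2𝓅} ≤ (1+4𝓅)^{2𝓅}t^{1/2}`, `t = e^{−1}`; for `𝓅 ≤ 0` the power is `≤ 1`.
[cite: BalabanImbrieJaffe1985, (7.3.1) p.326] -/
theorem sq_hyp731_le (pexp : ℝ) {e : ℝ} (he : 0 < e) (he1 : e ≤ 1) :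
    (e * (1 + Real.log e⁻¹) ^ pexp) ^ 2 ≤ (1 + 4 * max pexp 0) ^ (2 * max pexp 0) * e ^ (2 - 1 / 2 : ℝ) := by
  have ht : 1 ≤ e⁻¹ := (one_le_inv₀ he).2 he1
  have hlog : 0 ≤ Real.log e⁻¹ := Real.log_nonneg ht
  have hbase : 1 ≤ 1 + Real.log e⁻¹ := by linarith
  have hbase0 : 0 ≤ 1 + Real.log e⁻¹ := by linarith
  have h32 : (2 - 1 / 2 : ℝ) = 3 / 2 := by norm_num
  have he32 : e ^ 2 ≤ e ^ (3 / 2 : ℝ) := by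
    have h := Real.rpow_le_rpow_of_exponent_ge he he1 (show (3 / 2 : ℝ) ≤ 2 by norm_num)
    rwa [show ((2 : ℝ)) = ((2 : ℕ) : ℝ) by norm_num, Real.rpow_natCast] at h
  rw [h32, mul_pow]
  by_cases hp : pexp ≤ 0
  · -- 𝓅 ≤ 0: the power is ≤ 1 and the constant is 1
    have hCp : (1 + 4 * max pexp 0) ^ (2 * max pexp 0) = (1 : ℝ) := by simp [max_eq_right hp]
    have hr1 : (1 + Real.log e⁻¹) ^ pexp ≤ 1 := Real.rpow_le_one_of_one_le_of_nonpos hbase hp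
    have hr0 : 0 ≤ (1 + Real.log e⁻¹) ^ pexp := Real.rpow_nonneg hbase0 _
    rw [hCp, one_mul]
    calc e ^ 2 * ((1 + Real.log e⁻¹) ^ pexp) ^ 2 ≤ e ^ 2 * 1 := by
          refine mul_le_mul_of_nonneg_left ?_ (by positivity)
          nlinarith
      _ ≤ e ^ (3 / 2 : ℝ) := by rw [mul_one]; exact he32
  · -- 𝓅 > 0
    have hp' : 0 < pexp := lt_of_not_ge hp
    have hCp : (1 + 4 * max pexp 0) ^ (2 * max pexp 0) = (1 + 4 * pexp) ^ (2 * pexp) := by rw [max_eq_left hp'.le]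
    set t : ℝ := e⁻¹ with htdef
    have ht0 : 0 ≤ t := by positivity
    set β : ℝ := 1 / (4 * pexp) with hβ
    have hβ0 : 0 < β := by positivity
    -- 1 + ln t ≤ (1 + 4𝓅) t^β
    have hlt : Real.log t ≤ t ^ β / β := Real.log_le_rpow_div ht0 hβ0
    have htβ : 1 ≤ t ^ β := Real.one_le_rpow ht hβ0.le
    have h1 : 1 + Real.log t ≤ (1 + 4 * pexp) * t ^ β := by
      have e1 : t ^ β / β = 4 * pexp * t ^ β := by rw [hβ]; field_simp
      rw [e1] at hlt
      nlinarith
    -- raise to the power 2𝓅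
    have h2 : (1 + Real.log t) ^ (2 * pexp) ≤ ((1 + 4 * pexp) * t ^ β) ^ (2 * pexp) :=
      Real.rpow_le_rpow hbase0 h1 (by positivity)
    have h3 : ((1 + 4 * pexp) * t ^ β) ^ (2 * pexp) = (1 + 4 * pexp) ^ (2 * pexp) * t ^ (1 / 2 : ℝ) := by
      rw [Real.mul_rpow (by positivity) (Real.rpow_nonneg ht0 _), ← Real.rpow_mul ht0]
      congr 2
      rw [hβ]; field_simp; norm_num
    -- ((1 + ln t)^𝓅)² = (1 + ln t)^{2𝓅}
    have h4 : ((1 + Real.log t) ^ pexp) ^ 2 = (1 + Real.log t) ^ (2 * pexp) := by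
      rw [mul_comm, Real.rpow_mul hbase0, show ((2 : ℝ)) = ((2 : ℕ) : ℝ) by norm_num, Real.rpow_natCast]
    -- t^{1/2} = e^{−1/2}, and e²·e^{−1/2} = e^{3/2}
    have h5 : e ^ 2 * t ^ (1 / 2 : ℝ) = e ^ (3 / 2 : ℝ) := by
      rw [htdef, Real.inv_rpow he.le, ← Real.rpow_neg he.le, show ((e ^ 2 : ℝ)) = e ^ ((2 : ℕ) : ℝ) by
        rw [Real.rpow_natCast], ← Real.rpow_add he]
      norm_num
    rw [hCp, h4]
    calc e ^ 2 * (1 + Real.log t) ^ (2 * pexp) ≤ e ^ 2 * ((1 + 4 * pexp) ^ (2 * pexp) * t ^ (1 / 2 : ℝ)) :=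
          mul_le_mul_of_nonneg_left (h2.trans_eq h3) (by positivity)
      _ = (1 + 4 * pexp) ^ (2 * pexp) * (e ^ 2 * t ^ (1 / 2 : ℝ)) := by ring
      _ = (1 + 4 * pexp) ^ (2 * pexp) * e ^ (3 / 2 : ℝ) := by rw [h5]

end

end Literature.MathematicalPhysics.QuantumFieldTheory.BalabanImbrieJaffe1984to88.BIJ85Ineq732General
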